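import Summits.Ventures.Crystal3D.Theorems.StickyWulffConstantNoReconstructionGainCubeCross
import Summits.Ventures.Crystal3D.StickySpheres.ContactGraph
import HarnessLib

/-!
# The steep-or-flat layer bound for square layers (cube-facet spacing `1/√2`), any axis

HONEST FRAMING. Part of the venture `Summits/Ventures/Crystal3D` (cell `crystal3d-full`), helper
`--supports` the crux `NoReconstructionGain` (stmt-Ventures-19144, route
`route-Ventures-StickyWulffConstant`).  The `(100)` companion of
`StickyWulffConstantNoReconstructionGainSteepFlat.lean`: along an ARBITRARY unit axis `e`
(heights `h = ⟪x, e⟫`), a unit packing is CUBE-STEEP-OR-FLAT when every bond has `|Δh| ≤ 1/20`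
(flat) or `|Δh| ≥ √2/2` (steep: within `45°` of the axis — the inter-layer bonds of the square
`(100)` layers of fcc, spacing `1/√2`).  The class is off-lattice and contains every fcc lattice
packing seen along a cube axis, `(100)`-layered films with in-plane disorder (islands, vacancies,
antiphase domains, rafts) whose inter-layer bonds sit in hollow / bridge / atop geometry, and
adatom gases on a `(100)` facet with heights in `[1/√2, 1/√2 + 1/20]`.

**Theorem** (`three_mul_card_level_add_card_add_numContacts_le_cube`).  For such a packing and
every level `c`: `3 · E + E₄ + numContacts x ≤ 6 N`, where `E = #{i | h i = c}` and `E₄ ⊆ E`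
counts the level balls having four partners at `Δh ≤ −√2/2` (their lower square in place).  For
the balls of a complete square layer inside an fcc sample `E₄ = E`, giving the cube-facet
coefficient `4` of `four_mul_card_cubeLayer_add_numContacts_le` (`FccCubeFacetNoGain.lean`) —
now off-lattice.

**Proof.** Flat partners of any ball: `≤ 6` (thin band).  Steep bonds are charged to the endpoint
farther from the level (ties: the upper one); a ball off the level receives them from one side
only, inside a `45°` cap: `≤ 4` (`card_cap45_le_four`), and if it receives FOUR, the four are a
rigid square and the ball has `≤ 4` flat partners (`card_flat_le_four_of_cap45_four`); so
`flat + 2·steep-received ≤ 12` per ball off the level, `≤ 6` (resp. `≤ 4` on `E₄`) at the level.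

WHAT THIS IS NOT: the atom (oblique bonds `1/20 < |Δh| < √2/2` remain open); rung F-C1 not moved.
-/

noncomputable section

namespace Summit.Ventures.Crystal3D.Theorems

open Summit.Ventures.Crystal3D Finset Real
open scoped InnerProductSpace

/-- **The cube steep-or-flat layer bound.**  `e` a unit axis, `x : Fin N → ℝ³` a unit packing
whose bonds have each `|⟪x i − x j, e⟫| ≤ 1/20` or `≥ √2/2`, `c` a level.  With
`E = {i | ⟪x i, e⟫ = c}` and `E₄ = {i ∈ E | i has ≥ 4 partners j with ⟪x j − x i, e⟫ ≤ −√2/2}`: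
`3 · #E + #E₄ + numContacts x ≤ 6 N`. -/
theorem three_mul_card_level_add_card_add_numContacts_le_cube {N : ℕ}
    (e : EuclideanSpace ℝ (Fin 3)) (he : ‖e‖ = 1)
    (x : Fin N → EuclideanSpace ℝ (Fin 3)) (hx : IsUnitPacking x)
    (hsf : ∀ i j, dist (x i) (x j) = 1 →
      |⟪x i - x j, e⟫_ℝ| ≤ 1 / 20 ∨ Real.sqrt 2 / 2 ≤ |⟪x i - x j, e⟫_ℝ|) (c : ℝ) :
    3 * (univ.filter fun i => ⟪x i, e⟫_ℝ = c).card +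
      (univ.filter fun i => ⟪x i, e⟫_ℝ = c ∧
        4 ≤ (univ.filter fun j => dist (x i) (x j) = 1 ∧
          ⟪x j - x i, e⟫_ℝ ≤ -(Real.sqrt 2 / 2)).card).card +
      numContacts x ≤ 6 * N := by
  classical
  have hcpos : 0 < Real.sqrt 2 / 2 := by positivity
  have hc20 : (1 : ℝ) / 20 < Real.sqrt 2 / 2 := by
    nlinarith [Real.sq_sqrt (show (0 : ℝ) ≤ 2 by norm_num), Real.sqrt_nonneg 2]
  have hinjx := hx.injective
  -- heights
  set hgt : Fin N → ℝ := fun i => ⟪x i, e⟫_ℝ with hhgt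
  have hdh : ∀ i j, ⟪x i - x j, e⟫_ℝ = hgt i - hgt j := fun i j => by
    simp only [hhgt, inner_sub_left]
  simp only [hdh] at hsf ⊢
  -- unit bond vectors and their separation
  have hunit : ∀ i j, dist (x i) (x j) = 1 → ‖x j - x i‖ = 1 := by
    intro i j h; rw [← dist_eq_norm, dist_comm]; exact h
  have hsep : ∀ i j j', dist (x i) (x j) = 1 → dist (x i) (x j') = 1 → j ≠ j' →
      ⟪x j - x i, x j' - x i⟫_ℝ ≤ 1 / 2 := by
    intro i j j' hj hj' hne
    refine inner_le_half_of_one_le_dist (hunit i j hj) (hunit i j' hj') ?_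
    rw [dist_eq_norm, sub_sub_sub_cancel_right, ← dist_eq_norm]
    exact hx hne
  -- ordered touching pairs, flat and steep
  set P : Finset (Fin N × Fin N) :=
    univ.filter fun p => p.1 ≠ p.2 ∧ dist (x p.1) (x p.2) = 1 with hP
  have hPcard : P.card = 2 * numContacts x := by
    rw [← sum_coordination_eq, hP, card_filter, Fintype.sum_prod_type]
    refine sum_congr rfl fun i _ => ?_
    rw [coordination, contactNeighbors, card_filter]
    refine sum_congr rfl fun j _ => ?_
    by_cases hij : j = i
    · subst hij; simp
    · simp [hij, Ne.symm hij]
  set Pflat := P.filter fun p => |hgt p.1 - hgt p.2| ≤ 1 / 20 with hPflat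
  set Psteep := P.filter fun p => ¬ |hgt p.1 - hgt p.2| ≤ 1 / 20 with hPsteep
  have hsplit : P.card = Pflat.card + Psteep.card :=
    (card_filter_add_card_filter_not (s := P) _).symm
  have hsteep_of : ∀ p ∈ Psteep, Real.sqrt 2 / 2 ≤ |hgt p.1 - hgt p.2| := by
    intro p hp
    rw [hPsteep, mem_filter, hP, mem_filter] at hp
    exact (hsf p.1 p.2 hp.1.2.2).resolve_left hp.2
  -- the injection `p ↦ x p.2 − x p.1` on a fibre `p.1 = i`
  have hfib_inj : ∀ (S : Finset (Fin N × Fin N)) (i : Fin N), (∀ p ∈ S, p.1 = i) →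
      Set.InjOn (fun p : Fin N × Fin N => x p.2 - x p.1) ↑S := by
    intro S i hS p hp q hq hpq
    have hp1 := hS p (mem_coe.1 hp)
    have hq1 := hS q (mem_coe.1 hq)
    simp only [hp1, hq1, sub_left_inj] at hpq
    exact Prod.ext (hp1.trans hq1.symm) (hinjx hpq)
  -- the flat partners of a ball, as unit vectors
  set Fl : Fin N → Finset (EuclideanSpace ℝ (Fin 3)) := fun i =>
    (Pflat.filter fun p => p.1 = i).image fun p => x p.2 - x p.1 with hFl
  have hFl_card : ∀ i, (Pflat.filter fun p => p.1 = i).card = (Fl i).card := by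
    intro i
    rw [hFl, card_image_of_injOn (hfib_inj _ i fun p hp => (mem_filter.1 hp).2)]
  have hFl_mem : ∀ i, ∀ g ∈ Fl i, ∃ j, g = x j - x i ∧ dist (x i) (x j) = 1 ∧
      |hgt i - hgt j| ≤ 1 / 20 := by
    intro i g hg
    simp only [hFl, mem_image, mem_filter] at hg
    obtain ⟨p, ⟨hpP, hp1⟩, rfl⟩ := hg
    rw [hPflat, mem_filter, hP, mem_filter] at hpP
    subst hp1
    exact ⟨p.2, rfl, hpP.1.2.2, hpP.2⟩
  have hFl_unit : ∀ i, ∀ g ∈ Fl i, ‖g‖ = 1 := by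
    intro i g hg
    obtain ⟨j, rfl, hd, -⟩ := hFl_mem i g hg
    exact hunit i j hd
  have hFl_band : ∀ i, ∀ g ∈ Fl i, |⟪g, e⟫_ℝ| ≤ 1 / 5 := by
    intro i g hg
    obtain ⟨j, rfl, -, hf⟩ := hFl_mem i g hg
    rw [hdh, abs_sub_comm]; linarith
  have hFl_band' : ∀ i, ∀ g ∈ Fl i, |⟪g, e⟫_ℝ| ≤ 1 / 20 := by
    intro i g hg
    obtain ⟨j, rfl, -, hf⟩ := hFl_mem i g hg
    rw [hdh, abs_sub_comm]; exact hf
  have hFl_sep : ∀ i, ∀ g ∈ Fl i, ∀ g' ∈ Fl i, g ≠ g' → ⟪g, g'⟫_ℝ ≤ 1 / 2 := by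
    intro i g hg g' hg' hne
    obtain ⟨j, rfl, hd, -⟩ := hFl_mem i g hg
    obtain ⟨j', rfl, hd', -⟩ := hFl_mem i g' hg'
    exact hsep i j j' hd hd' fun h => hne (by rw [h])
  -- (i) at most six flat partners
  have hflat6 : ∀ i, (Fl i).card ≤ 6 := fun i =>
    card_thin_band_le_six_axis e he (hFl_unit i) (hFl_band i) (hFl_sep i)
  -- (ii) four steep partners on one side force at most four flat partners
  have hflat4 : ∀ i (S : Finset (Fin N)), S.card = 4 →
      ((∀ j ∈ S, dist (x i) (x j) = 1 ∧ hgt j - hgt i ≤ -(Real.sqrt 2 / 2)) ∨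
        (∀ j ∈ S, dist (x i) (x j) = 1 ∧ Real.sqrt 2 / 2 ≤ hgt j - hgt i)) →
      (Fl i).card ≤ 4 := by
    intro i S hS hside
    set eqv := (Finset.equivFinOfCardEq hS).symm with heqv
    set u : Fin 4 → EuclideanSpace ℝ (Fin 3) := fun k => x (eqv k : S) - x i with hu
    have hSmem : ∀ k, ((eqv k : S) : Fin N) ∈ S := fun k => (eqv k).2
    have hdist : ∀ k, dist (x i) (x (eqv k : S)) = 1 := fun k => by
      rcases hside with h | h
      · exact (h _ (hSmem k)).1
      · exact (h _ (hSmem k)).1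
    have hun : ∀ k, ‖u k‖ = 1 := fun k => hunit i _ (hdist k)
    have husep : ∀ k l, k ≠ l → ⟪u k, u l⟫_ℝ ≤ 1 / 2 := by
      intro k l hkl
      refine hsep i _ _ (hdist k) (hdist l) fun h => hkl ?_
      exact eqv.injective (Subtype.val_injective h)
    -- a flat partner is never one of the steep four
    have hGu : ∀ g ∈ Fl i, ∀ k, ⟪g, u k⟫_ℝ ≤ 1 / 2 := by
      intro g hg k
      obtain ⟨j, rfl, hd, hf⟩ := hFl_mem i g hg
      refine hsep i j _ hd (hdist k) fun h => ?_
      rcases hside with hs | hs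
      · have := (hs _ (hSmem k)).2
        rw [← h] at this
        have hf' := (abs_le.1 hf).2
        linarith
      · have := (hs _ (hSmem k)).2
        rw [← h] at this
        have hf' := (abs_le.1 hf).1
        linarith
    rcases hside with hs | hs
    · refine card_flat_le_four_of_cap45_four e he u hun (fun k => ?_) husep (hFl_unit i)
        (hFl_band' i) hGu (hFl_sep i)
      simp only [hu]; rw [hdh]; exact (hs _ (hSmem k)).2
    · refine card_flat_le_four_of_cap45_four' e he u hun (fun k => ?_) husep (hFl_unit i)
        (hFl_band' i) hGu (hFl_sep i)
      simp only [hu]; rw [hdh]; exact (hs _ (hSmem k)).2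
  -- FLAT pairs as a sum over balls
  have hflat_sum : Pflat.card = ∑ i, (Fl i).card := by
    have hmaps : ((Pflat : Set (Fin N × Fin N))).MapsTo Prod.fst (univ : Finset (Fin N)) :=
      fun p _ => mem_coe.2 (mem_univ _)
    rw [card_eq_sum_card_fiberwise hmaps]
    exact sum_congr rfl fun i _ => hFl_card i
  -- STEEP pairs: the charging tournament
  set charged : Fin N × Fin N → Prop := fun p =>
    |hgt p.2 - c| < |hgt p.1 - c| ∨ (|hgt p.2 - c| = |hgt p.1 - c| ∧ hgt p.2 < hgt p.1)
    with hcharged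
  set A := Psteep.filter fun p => charged p with hA
  set B := Psteep.filter fun p => ¬ charged p with hB
  have hAB : Psteep.card = A.card + B.card := (card_filter_add_card_filter_not (s := Psteep) _).symm
  have hPsymm : ∀ p : Fin N × Fin N, p ∈ Psteep ↔ p.swap ∈ Psteep := by
    suffices h : ∀ p : Fin N × Fin N, p ∈ Psteep → p.swap ∈ Psteep from
      fun p => ⟨h p, fun h' => by simpa using h p.swap h'⟩
    intro p hp
    rw [hPsteep, mem_filter, hP, mem_filter] at hp ⊢
    refine ⟨⟨mem_univ _, hp.1.2.1.symm, by rw [dist_comm]; exact hp.1.2.2⟩, ?_⟩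
    rw [Prod.fst_swap, Prod.snd_swap, abs_sub_comm]; exact hp.2
  have hBA : B = A.image Prod.swap := by
    ext p
    rw [hB, mem_filter, mem_image]
    constructor
    · rintro ⟨hp, hnc⟩
      refine ⟨p.swap, ?_, Prod.swap_swap p⟩
      rw [hA, mem_filter]
      refine ⟨(hPsymm p).1 hp, ?_⟩
      have hst := hsteep_of p hp
      have hne : hgt p.1 ≠ hgt p.2 := by
        intro h; rw [h, sub_self, abs_zero] at hst; linarith
      simp only [hcharged, Prod.fst_swap, Prod.snd_swap] at hnc ⊢
      rcases lt_trichotomy |hgt p.1 - c| |hgt p.2 - c| with hlt | heq | hgt'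
      · exact Or.inl hlt
      · right; refine ⟨heq, ?_⟩
        rcases lt_or_gt_of_ne hne with h1 | h1
        · exact h1
        · exact absurd (Or.inr ⟨heq.symm, h1⟩) hnc
      · exact absurd (Or.inl hgt') hnc
    · rintro ⟨q, hq, rfl⟩
      rw [hA, mem_filter] at hq
      refine ⟨(hPsymm q).1 hq.1, ?_⟩
      have hcq := hq.2
      simp only [hcharged, Prod.fst_swap, Prod.snd_swap] at hcq ⊢
      rintro (hlt | ⟨heq, hlt⟩)
      · rcases hcq with h | ⟨h, -⟩
        · exact absurd (hlt.trans h) (lt_irrefl _)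
        · rw [h] at hlt; exact lt_irrefl _ hlt
      · rcases hcq with h | ⟨-, h⟩
        · rw [heq] at h; exact lt_irrefl _ h
        · exact absurd (hlt.trans h) (lt_irrefl _)
  have hBcard : B.card = A.card := by
    rw [hBA, card_image_of_injective _ Prod.swap_injective]
  -- the charged steep partners of a ball, as unit vectors on ONE side
  set St : Fin N → Finset (EuclideanSpace ℝ (Fin 3)) := fun i =>
    (A.filter fun p => p.1 = i).image fun p => x p.2 - x p.1 with hSt
  have hSt_card : ∀ i, (A.filter fun p => p.1 = i).card = (St i).card := by
    intro i
    rw [hSt, card_image_of_injOn (hfib_inj _ i fun p hp => (mem_filter.1 hp).2)]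
  have hSt_mem : ∀ i, ∀ g ∈ St i, ∃ j, g = x j - x i ∧ dist (x i) (x j) = 1 ∧
      Real.sqrt 2 / 2 ≤ |hgt i - hgt j| ∧ charged (i, j) := by
    intro i g hg
    simp only [hSt, mem_image, mem_filter] at hg
    obtain ⟨p, ⟨hpA, hp1⟩, rfl⟩ := hg
    rw [hA, mem_filter] at hpA
    obtain ⟨hpP, hpc⟩ := hpA
    have hst := hsteep_of p hpP
    rw [hPsteep, mem_filter, hP, mem_filter] at hpP
    subst hp1
    exact ⟨p.2, rfl, hpP.1.2.2, hst, hpc⟩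
  -- the side of the charged partners
  have hside : ∀ i j, dist (x i) (x j) = 1 → Real.sqrt 2 / 2 ≤ |hgt i - hgt j| →
      charged (i, j) →
      (c < hgt i → hgt j - hgt i ≤ -(Real.sqrt 2 / 2)) ∧
        (hgt i < c → Real.sqrt 2 / 2 ≤ hgt j - hgt i) ∧ hgt i ≠ c := by
    intro i j _ hst hpc
    simp only [hcharged] at hpc
    refine ⟨fun hci => ?_, fun hci => ?_, fun hci => ?_⟩
    · rcases le_or_gt (hgt j) (hgt i) with hle | hgt'
      · rw [abs_of_nonneg (by linarith)] at hst; linarith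
      · exfalso
        rw [abs_of_nonpos (by linarith)] at hst
        have h1 : |hgt i - c| = hgt i - c := abs_of_pos (by linarith)
        have h2 : |hgt j - c| = hgt j - c := abs_of_pos (by linarith)
        rw [h1, h2] at hpc
        rcases hpc with h | ⟨h, h'⟩ <;> linarith
    · rcases le_or_gt (hgt i) (hgt j) with hle | hgt'
      · rw [abs_of_nonpos (by linarith)] at hst; linarith
      · exfalso
        rw [abs_of_nonneg (by linarith)] at hst
        have h1 : |hgt i - c| = c - hgt i := by rw [abs_sub_comm]; exact abs_of_pos (by linarith)
        have h2 : |hgt j - c| = c - hgt j := by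
          rw [abs_sub_comm]; exact abs_of_pos (by linarith)
        rw [h1, h2] at hpc
        rcases hpc with h | ⟨h, h'⟩ <;> linarith
    · rw [hci, sub_self, abs_zero] at hpc
      rcases hpc with h | ⟨h, h'⟩
      · exact absurd h (not_lt.2 (abs_nonneg _))
      · have : hgt j = c := by
          have := abs_eq_zero.1 h; linarith
        linarith
  have hSt_unit : ∀ i, ∀ g ∈ St i, ‖g‖ = 1 := by
    intro i g hg
    obtain ⟨j, rfl, hd, -⟩ := hSt_mem i g hg
    exact hunit i j hd
  have hSt_sep : ∀ i, ∀ g ∈ St i, ∀ g' ∈ St i, g ≠ g' → ⟪g, g'⟫_ℝ ≤ 1 / 2 := by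
    intro i g hg g' hg' hne
    obtain ⟨j, rfl, hd, -⟩ := hSt_mem i g hg
    obtain ⟨j', rfl, hd', -⟩ := hSt_mem i g' hg'
    exact hsep i j j' hd hd' fun h => hne (by rw [h])
  -- (iii) no charges at the level, at most four elsewhere, and four force `≤ 4` flat partners
  have hlevel0 : ∀ i, hgt i = c → (St i).card = 0 := by
    intro i hci
    rw [card_eq_zero, eq_empty_iff_forall_notMem]
    intro g hg
    obtain ⟨j, rfl, hd, hst, hpc⟩ := hSt_mem i g hg
    exact (hside i j hd hst hpc).2.2 hci
  have hsteep4 : ∀ i, (St i).card ≤ 4 := by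
    intro i
    by_cases hci : hgt i = c
    · rw [hlevel0 i hci]; norm_num
    rcases lt_or_gt_of_ne hci with hlt | hgt'
    · refine card_cap45_le_four' e he (hSt_unit i) (fun g hg => ?_) (hSt_sep i)
      obtain ⟨j, rfl, hd, hst, hpc⟩ := hSt_mem i g hg
      rw [hdh]; exact (hside i j hd hst hpc).2.1 hlt
    · refine card_cap45_le_four e he (hSt_unit i) (fun g hg => ?_) (hSt_sep i)
      obtain ⟨j, rfl, hd, hst, hpc⟩ := hSt_mem i g hg
      rw [hdh]; exact (hside i j hd hst hpc).1 hgt'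
  have hsteep_flat : ∀ i, (St i).card = 4 → (Fl i).card ≤ 4 := by
    intro i h4
    have hci : hgt i ≠ c := by
      intro hci; rw [hlevel0 i hci] at h4; exact absurd h4 (by norm_num)
    -- the four partners as a set of indices
    set S : Finset (Fin N) := (A.filter fun p => p.1 = i).image Prod.snd with hS
    have hScard : S.card = 4 := by
      rw [hS, card_image_of_injOn, hSt_card i, h4]
      intro p hp q hq hpq
      have hp1 := (mem_filter.1 (mem_coe.1 hp)).2
      have hq1 := (mem_filter.1 (mem_coe.1 hq)).2
      exact Prod.ext (hp1.trans hq1.symm) hpq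
    have hSmem : ∀ j ∈ S, dist (x i) (x j) = 1 ∧ Real.sqrt 2 / 2 ≤ |hgt i - hgt j| ∧
        charged (i, j) := by
      intro j hj
      rw [hS, mem_image] at hj
      obtain ⟨p, hp, rfl⟩ := hj
      rw [mem_filter] at hp
      have hpA := hp.1
      rw [hA, mem_filter] at hpA
      have hst := hsteep_of p hpA.1
      have hpP := hpA.1
      rw [hPsteep, mem_filter, hP, mem_filter] at hpP
      have : p = (i, p.2) := Prod.ext hp.2 rfl
      rw [this] at hpA hst hpP
      exact ⟨hpP.1.2.2, hst, hpA.2⟩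
    refine hflat4 i S hScard ?_
    rcases lt_or_gt_of_ne hci with hlt | hgt'
    · right
      intro j hj
      obtain ⟨hd, hst, hpc⟩ := hSmem j hj
      exact ⟨hd, (hside i j hd hst hpc).2.1 hlt⟩
    · left
      intro j hj
      obtain ⟨hd, hst, hpc⟩ := hSmem j hj
      exact ⟨hd, (hside i j hd hst hpc).1 hgt'⟩
  -- per-ball inequality
  set E := univ.filter fun i => hgt i = c with hE
  set E4 := univ.filter fun i => hgt i = c ∧
    4 ≤ (univ.filter fun j => dist (x i) (x j) = 1 ∧
      hgt j - hgt i ≤ -(Real.sqrt 2 / 2)).card with hE4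
  have hE4flat : ∀ i ∈ E4, (Fl i).card ≤ 4 := by
    intro i hi
    rw [hE4, mem_filter] at hi
    obtain ⟨-, -, h4⟩ := hi
    obtain ⟨S, hS, hScard⟩ := Finset.exists_subset_card_eq h4
    refine hflat4 i S hScard (Or.inl fun j hj => ?_)
    have := mem_filter.1 (hS hj)
    exact this.2
  have hball : ∀ i, (Fl i).card + 2 * (St i).card + (if hgt i = c then 6 else 0) +
      (if i ∈ E4 then 2 else 0) ≤ 12 := by
    intro i
    by_cases hci : hgt i = c
    · rw [if_pos hci, hlevel0 i hci]
      by_cases hi4 : i ∈ E4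
      · rw [if_pos hi4]; have := hE4flat i hi4; omega
      · rw [if_neg hi4]; have := hflat6 i; omega
    · rw [if_neg hci]
      have hi4 : i ∉ E4 := by
        rw [hE4, mem_filter]; exact fun h => hci h.2.1
      rw [if_neg hi4]
      have h4 := hsteep4 i
      have h6 := hflat6 i
      rcases Nat.lt_or_ge (St i).card 4 with hlt | hge
      · omega
      · have := hsteep_flat i (le_antisymm h4 hge); omega
  -- sum over balls
  have hsum := sum_le_sum fun i (_ : i ∈ (univ : Finset (Fin N))) => hball i
  simp only [sum_add_distrib, sum_const, card_univ, Fintype.card_fin, smul_eq_mul] at hsum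
  have hE' : ∑ i, (if hgt i = c then 6 else 0) = 6 * E.card := by
    rw [← sum_filter, hE]; simp [sum_const, mul_comm]
  have hE4' : ∑ i, (if i ∈ E4 then 2 else 0) = 2 * E4.card := by
    rw [← sum_filter]; simp [sum_const, mul_comm]
  have hAsum : A.card = ∑ i, (St i).card := by
    have hmaps : ((A : Set (Fin N × Fin N))).MapsTo Prod.fst (univ : Finset (Fin N)) :=
      fun p _ => mem_coe.2 (mem_univ _)
    rw [card_eq_sum_card_fiberwise hmaps]
    exact sum_congr rfl fun i _ => hSt_card i
  rw [hE', hE4', ← mul_sum] at hsum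
  rw [← hflat_sum, ← hAsum] at hsum
  show 3 * E.card + E4.card + numContacts x ≤ 6 * N
  omega

end Summit.Ventures.Crystal3D.Theorems

end
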